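import Summits.CriticalPhenomena.PercolationContinuityZ3.Theorems.PercNearOneGluingNoHeavyPcintNawReduction
import HarnessLib

/-!
# PCINT lane, a closed-form kernel bound: `p_c^site(ℤ^d) ≥ 1/((d-1) + √((d-1)²+1))` (memory-4 neighbour-avoiding walks)

Cell `prim-pcint` (PAPER-2 track (iii)), seat `prim-pcint-2`; memo `run/shared/lean/prim/pcint/REDUCTIONS.md` §B2
and INTERVAL-PLAN.md §10.  Does NOT build on p205010.

By the B2 reduction (`siteTheta_le_card_nawWords_mul_pow`: a shortest open path of the site model is an induced
= neighbour-avoiding walk, NAW) `θ^site(p) ≤ N_n p^{n+1}`, `N_n` = number of `n`-step NAWs from the origin.  A NAW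
has MEMORY-4 NEIGHBOUR-AVOIDANCE: no step reverses either of the two previous steps (reversing the previous step
revisits a site; reversing the last-but-one step, `(a, b, -a)` with `b ⟂ a`, puts `v_{k+3}` next to `v_k`, a chord).
Such words are counted by the two-class linear recursion (last two steps equal / perpendicular)
`S' ≤ S + T`, `T' ≤ (2d-2) S + (2d-3) T`, whose Perron root is `λ_d = (d-1) + √((d-1)²+1)` (`d = 3`: `2 + √5`,
Pönitz–Tittmann-type memory-4 constant for NAWs; the tree's STEP-0 engines find exactly this value at `τ = 4`).
Hence `N_{n+2} ≤ C λ_dⁿ⁺¹`, `θ^site(p) = 0` for `p < 1/λ_d`, and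

  `p_c^site(ℤ^d) ≥ 1/λ_d = 1/((d-1) + √((d-1)²+1))`   (`siteCriticalProb_zd_ge_inv_nawFourConst`),

`d = 3: ≥ 1/(2+√5) > 0.236`, `d = 4: > 0.1622`, `d = 5: > 0.1231`, `d = 6: > 0.099` — each above the printed
lower bound `1/μ(d)` (0.2110, 0.1470, 0.1129, 0.0918; PUBLISHED-BOUNDS.md §0), kernel-checked, no certificate.

Main results (namespace `Summit.CriticalPhenomena.PercolationContinuityZ3.Theorems.Pcint`):
* `IsNAWFour`, `nawFourWords`; `isNAWFour_of_naw` (SAW with no chord edge ⇒ memory-4 neighbour-avoiding);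
* `card_nawFourS_succ_le`, `card_nawFourT_succ_le` (the two-class recursion), `card_nawFourWords_le_geometric`;
* `siteTheta_zd_eq_zero_of_lt_inv`, `inv_le_siteCriticalProb_zd_of_sq`, `siteCriticalProb_zd_ge_inv_nawFourConst`,
  `siteCriticalProb_Z3_ge` (`0.236 ≤ p_c^site(ℤ³)`).
-/

noncomputable section

namespace Summit.CriticalPhenomena.PercolationContinuityZ3.Theorems.Pcint

open MeasureTheory Filter Topology Literature.Probability.Percolation Literature.Probability.LatticeModels

variable {d : ℕ}

/-! ### Memory-4 neighbour-avoiding words -/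

/-- A step word is **memory-4 neighbour-avoiding** if no step reverses the previous step and no step reverses
the last-but-one step (walks with finite memory in the sense of Madras–Slade §1.2, here for the neighbour-avoiding
constraint). [cite: MadrasSlade1993, §1.2 (walks with finite memory τ, (1.2.12)–(1.2.14))] -/
def IsNAWFour {n : ℕ} (w : Fin n → Fin d × Bool) : Prop :=
  (∀ (k : ℕ) (hk : k + 1 < n), w ⟨k + 1, hk⟩ ≠ srev (w ⟨k, by omega⟩)) ∧
    ∀ (k : ℕ) (hk : k + 2 < n), w ⟨k + 2, hk⟩ ≠ srev (w ⟨k, by omega⟩)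

open Classical in
/-- The finite set of memory-4 neighbour-avoiding words of length `n`. [folklore] -/
def nawFourWords (d n : ℕ) : Finset (Fin n → Fin d × Bool) :=
  Finset.univ.filter fun w => IsNAWFour w

/-- Membership in `nawFourWords`. [folklore] -/
@[simp] theorem mem_nawFourWords {n : ℕ} {w : Fin n → Fin d × Bool} :
    w ∈ nawFourWords d n ↔ IsNAWFour w := by
  simp [nawFourWords]

/-- After a pattern `(a, b, -a)` the walk stands next to where it stood three steps earlier:
`wordPos w (k+3) = wordPos w k + stepVec (w (k+1))`. [folklore] -/
theorem wordPos_add_three_of_srev {n : ℕ} (w : Fin n → Fin d × Bool) {k : ℕ} (hk : k + 2 < n)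
    (h : w ⟨k + 2, hk⟩ = srev (w ⟨k, by omega⟩)) :
    wordPos w (k + 3) = wordPos w k + stepVec (w ⟨k + 1, by omega⟩) := by
  have e1 : wordPos w (k + 1) = wordPos w k + stepVec (w ⟨k, by omega⟩) := wordPos_succ w _
  have e2 : wordPos w (k + 2) = wordPos w (k + 1) + stepVec (w ⟨k + 1, by omega⟩) := wordPos_succ w _
  have e3 : wordPos w (k + 3) = wordPos w (k + 2) + stepVec (w ⟨k + 2, hk⟩) := wordPos_succ w hk
  rw [e3, e2, e1, h, stepVec_srev]
  abel

/-- **A neighbour-avoiding walk is memory-4 neighbour-avoiding**: a self-avoiding word with no chord edge has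
no reversal (it would revisit a site) and no pattern `(a, b, -a)` (it would create the chord `{v_k, v_{k+3}}`).
[folklore] -/
theorem isNAWFour_of_naw {n : ℕ} {w : Fin n → Fin d × Bool} (hs : IsSAW w) (hc : chordEdges w = ∅) :
    IsNAWFour w := by
  refine ⟨fun k hk hrev => ?_, fun k hk hrev => ?_⟩
  · have := hs (k + 2) k (by omega) (by omega) (wordPos_add_two_of_srev w hk hrev)
    omega
  · have hpos := wordPos_add_three_of_srev w hk hrev
    have hadj : (zdGraph d).Adj (wordPos w k) (wordPos w (k + 3)) :=
      (zdGraph_adj_iff_stepVec _ _).2 ⟨w ⟨k + 1, by omega⟩, hpos⟩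
    have hmem : s(wordPos w k, wordPos w (k + 3)) ∈ chordEdges w :=
      mem_chordEdges.2 ⟨k, k + 3, by omega, by omega, hadj, rfl⟩
    rw [hc] at hmem
    exact absurd hmem (Finset.notMem_empty _)

/-- Hence `N_n ≤ #nawFourWords`: the neighbour-avoiding words are memory-4 neighbour-avoiding. [folklore] -/
theorem card_nawWords_le_card_nawFourWords (d n : ℕ) :
    ((sawWords d n).filter fun w => chordEdges w = ∅).card ≤ (nawFourWords d n).card := by
  classical
  refine Finset.card_le_card fun w hw => ?_
  rw [Finset.mem_filter, mem_sawWords] at hw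
  exact mem_nawFourWords.2 (isNAWFour_of_naw hw.1 hw.2)

/-! ### The two-class recursion -/

/-- Prefix (first `n` steps) of a word of length `n + 1`. [folklore] -/
def wordInit' {n : ℕ} (w : Fin (n + 1) → Fin d × Bool) : Fin n → Fin d × Bool :=
  fun i => w ⟨i.1, by omega⟩

/-- A word of length `n + 1` is determined by its prefix and its last step. [folklore] -/
theorem wordInit'_last_injective (n : ℕ) :
    Function.Injective fun w : Fin (n + 1) → Fin d × Bool => (wordInit' w, w ⟨n, by omega⟩) := by
  intro w w' h
  simp only [Prod.mk.injEq] at h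
  obtain ⟨hp, hl⟩ := h
  funext j
  by_cases hj : j.1 < n
  · have := congrFun hp ⟨j.1, hj⟩
    simpa [wordInit'] using this
  · have hj' : j.1 = n := by omega
    have hjn : j = ⟨n, by omega⟩ := Fin.ext hj'
    rw [hjn]; exact hl

/-- The prefix of a memory-4 neighbour-avoiding word is memory-4 neighbour-avoiding. [folklore] -/
theorem IsNAWFour.wordInit' {n : ℕ} {w : Fin (n + 1) → Fin d × Bool} (h : IsNAWFour w) :
    IsNAWFour (wordInit' w) :=
  ⟨fun k hk => h.1 k (by omega), fun k hk => h.2 k (by omega)⟩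

open Classical in
/-- Class `S`: memory-4 NAW words of length `n + 2` whose last two steps are EQUAL. [folklore] -/
def nawFourS (d n : ℕ) : Finset (Fin (n + 2) → Fin d × Bool) :=
  (nawFourWords d (n + 2)).filter fun w => w ⟨n + 1, by omega⟩ = w ⟨n, by omega⟩

open Classical in
/-- Class `T`: memory-4 NAW words of length `n + 2` whose last two steps DIFFER (hence are perpendicular).
[folklore] -/
def nawFourT (d n : ℕ) : Finset (Fin (n + 2) → Fin d × Bool) :=
  (nawFourWords d (n + 2)).filter fun w => w ⟨n + 1, by omega⟩ ≠ w ⟨n, by omega⟩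

/-- `#nawFourWords (n+2) = S_n + T_n`. [folklore] -/
theorem card_nawFourWords_eq (d n : ℕ) :
    (nawFourWords d (n + 2)).card = (nawFourS d n).card + (nawFourT d n).card := by
  classical
  rw [nawFourS, nawFourT, Finset.card_filter_add_card_filter_not]

/-- **`S_{n+1} ≤ S_n + T_n`**: a word ending in two equal steps is determined by its prefix. [folklore] -/
theorem card_nawFourS_succ_le (d n : ℕ) :
    (nawFourS d (n + 1)).card ≤ (nawFourWords d (n + 2)).card := by
  classical
  refine Finset.card_le_card_of_injOn (fun w => wordInit' w) (fun w hw => ?_) (fun w hw w' hw' h => ?_)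
  · rw [Finset.mem_coe, nawFourS, Finset.mem_filter, mem_nawFourWords] at hw
    rw [Finset.mem_coe, mem_nawFourWords]
    exact hw.1.wordInit'
  · rw [Finset.mem_coe, nawFourS, Finset.mem_filter] at hw hw'
    apply wordInit'_last_injective (n + 2)
    refine Prod.ext h ?_
    show w ⟨n + 2, _⟩ = w' ⟨n + 2, _⟩
    rw [hw.2, hw'.2]
    have := congrFun h ⟨n + 1, by omega⟩
    simpa [wordInit'] using this

/-- The admissible next steps after the last two steps `(a, b)`: not `b` (that continuation goes to class `S`),
not `-b`, not `-a`. [folklore] -/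
def nextT (a b : Fin d × Bool) : Finset (Fin d × Bool) :=
  Finset.univ.filter fun c => c ≠ b ∧ c ≠ srev b ∧ c ≠ srev a

/-- `#nextT a b ≤ 2d - 2` when `a = b`, and `≤ 2d - 3` when `a ≠ b` and `b ≠ -a` (three distinct exclusions).
[folklore] -/
theorem card_nextT_le (a b : Fin d × Bool) (hab : b ≠ srev a) :
    (nextT a b).card ≤ if a = b then 2 * d - 2 else 2 * d - 3 := by
  classical
  have huniv : Fintype.card (Fin d × Bool) = 2 * d := by
    rw [Fintype.card_prod, Fintype.card_fin, Fintype.card_bool, mul_comm]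
  have hsub : nextT a b = ({b, srev b, srev a} : Finset (Fin d × Bool))ᶜ := by
    ext c
    simp only [nextT, Finset.mem_filter, Finset.mem_univ, true_and, Finset.mem_compl,
      Finset.mem_insert, Finset.mem_singleton, not_or]
  rw [hsub, Finset.card_compl, huniv]
  have hb : srev b ≠ b := srev_ne_self b
  split_ifs with h
  · subst h
    have : ({a, srev a, srev a} : Finset (Fin d × Bool)).card = 2 := by
      rw [Finset.insert_eq_of_mem (s := {srev a}) (Finset.mem_singleton_self _) |> congrArg (insert a),
        Finset.card_insert_of_notMem (by simpa using hb.symm), Finset.card_singleton]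
    omega
  · have h1 : b ≠ srev a := hab
    have h2 : srev b ≠ srev a := fun h' => h (srev_injective h').symm
    have : ({b, srev b, srev a} : Finset (Fin d × Bool)).card = 3 := by
      rw [Finset.card_insert_of_notMem, Finset.card_insert_of_notMem, Finset.card_singleton]
      · simpa using h2
      · simp only [Finset.mem_insert, Finset.mem_singleton, not_or]; exact ⟨hb.symm, h1⟩
    omega

/-- **`T_{n+1} ≤ (2d-2) S_n + (2d-3) T_n`**: a word of class `T` is its prefix followed by one of the
`nextT`-admissible steps. [folklore] -/
theorem card_nawFourT_succ_le (d n : ℕ) :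
    (nawFourT d (n + 1)).card ≤ (2 * d - 2) * (nawFourS d n).card + (2 * d - 3) * (nawFourT d n).card := by
  classical
  set F : (Fin (n + 3) → Fin d × Bool) → (Σ _ : Fin (n + 2) → Fin d × Bool, Fin d × Bool) :=
    fun w => ⟨wordInit' w, w ⟨n + 2, by omega⟩⟩ with hF
  set Tg := (nawFourWords d (n + 2)).sigma fun u => nextT (u ⟨n, by omega⟩) (u ⟨n + 1, by omega⟩) with hTg
  have hmaps : Set.MapsTo F (nawFourT d (n + 1) : Set _) (Tg : Set _) := by
    intro w hw
    rw [Finset.mem_coe, nawFourT, Finset.mem_filter, mem_nawFourWords] at hw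
    obtain ⟨hw4, hne⟩ := hw
    rw [Finset.mem_coe, hTg, Finset.mem_sigma, mem_nawFourWords]
    refine ⟨hw4.wordInit', ?_⟩
    rw [nextT, Finset.mem_filter]
    simp only [hF, wordInit']
    exact ⟨Finset.mem_univ _, hne, hw4.1 (n + 1) (by omega), hw4.2 n (by omega)⟩
  have hinj : Set.InjOn F (nawFourT d (n + 1) : Set _) := by
    intro w _ w' _ h
    simp only [hF, Sigma.mk.injEq, heq_eq_eq] at h
    exact wordInit'_last_injective (n + 2) (Prod.ext h.1 h.2)
  calc (nawFourT d (n + 1)).card ≤ Tg.card := Finset.card_le_card_of_injOn F hmaps hinj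
    _ = ∑ u ∈ nawFourWords d (n + 2), (nextT (u ⟨n, by omega⟩) (u ⟨n + 1, by omega⟩)).card :=
        Finset.card_sigma _ _
    _ ≤ ∑ u ∈ nawFourWords d (n + 2), (if u ⟨n, by omega⟩ = u ⟨n + 1, by omega⟩ then 2 * d - 2 else 2 * d - 3) :=
        Finset.sum_le_sum fun u hu => card_nextT_le _ _ ((mem_nawFourWords.1 hu).1 n (by omega))
    _ = (2 * d - 2) * (nawFourS d n).card + (2 * d - 3) * (nawFourT d n).card := by
        rw [← Finset.sum_filter_add_sum_filter_not (nawFourWords d (n + 2))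
          (fun u => u ⟨n + 1, by omega⟩ = u ⟨n, by omega⟩)]
        change (∑ u ∈ nawFourS d n, _) + (∑ u ∈ nawFourT d n, _) = _
        have hS : ∀ u ∈ nawFourS d n,
            (if u ⟨n, by omega⟩ = u ⟨n + 1, by omega⟩ then 2 * d - 2 else 2 * d - 3) = 2 * d - 2 := by
          intro u hu
          rw [nawFourS, Finset.mem_filter] at hu
          rw [if_pos hu.2.symm]
        have hT : ∀ u ∈ nawFourT d n,
            (if u ⟨n, by omega⟩ = u ⟨n + 1, by omega⟩ then 2 * d - 2 else 2 * d - 3) = 2 * d - 3 := by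
          intro u hu
          rw [nawFourT, Finset.mem_filter] at hu
          rw [if_neg (fun h => hu.2 h.symm)]
        rw [Finset.sum_congr rfl hS, Finset.sum_congr rfl hT, Finset.sum_const, Finset.sum_const, smul_eq_mul,
          smul_eq_mul, mul_comm (nawFourS d n).card, mul_comm (nawFourT d n).card]

/-! ### Geometric growth at the Perron root `λ_d`: `λ² ≥ (2d-2)λ + 1` -/

/-- **Growth bound.** If `λ ≥ 2` satisfies `λ² ≥ (2d-2)λ + 1` (i.e. `λ ≥ λ_d = (d-1) + √((d-1)²+1)`), then
`S_n ≤ C λⁿ` and `T_n ≤ C λⁿ (λ - 1)` with `C = 4d²`, by induction along the two-class recursion (the vector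
`(1, λ-1)` is a Perron super-vector). [folklore] -/
theorem card_nawFourST_le (hd : 2 ≤ d) {lam : ℝ} (hlam : 2 ≤ lam)
    (hroot : (2 * d - 2 : ℝ) * lam + 1 ≤ lam ^ 2) (n : ℕ) :
    ((nawFourS d n).card : ℝ) ≤ 4 * d ^ 2 * lam ^ n ∧
      ((nawFourT d n).card : ℝ) ≤ 4 * d ^ 2 * lam ^ n * (lam - 1) := by
  have e2 : ((2 * d - 2 : ℕ) : ℝ) = 2 * d - 2 := by
    rw [Nat.cast_sub (by omega : 2 ≤ 2 * d)]; push_cast; ring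
  have e3 : ((2 * d - 3 : ℕ) : ℝ) = 2 * d - 3 := by
    rw [Nat.cast_sub (by omega : 3 ≤ 2 * d)]; push_cast; ring
  induction n with
  | zero =>
    have hcrude : ∀ s : Finset (Fin 2 → Fin d × Bool), (s.card : ℝ) ≤ 4 * d ^ 2 := by
      intro s
      have h := Finset.card_le_univ s
      rw [Fintype.card_fun, Fintype.card_prod, Fintype.card_fin, Fintype.card_fin, Fintype.card_bool] at h
      have e : (((d * 2) ^ 2 : ℕ) : ℝ) = 4 * d ^ 2 := by push_cast; ring
      calc (s.card : ℝ) ≤ (((d * 2) ^ 2 : ℕ) : ℝ) := by exact_mod_cast h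
        _ = 4 * d ^ 2 := e
    refine ⟨by simpa using hcrude _, ?_⟩
    have h0 : (0 : ℝ) ≤ 4 * d ^ 2 := by positivity
    calc ((nawFourT d 0).card : ℝ) ≤ 4 * d ^ 2 := hcrude _
      _ ≤ 4 * d ^ 2 * lam ^ 0 * (lam - 1) := by rw [pow_zero, mul_one]; nlinarith
  | succ n ih =>
    obtain ⟨ihS, ihT⟩ := ih
    have hC : (0 : ℝ) ≤ 4 * d ^ 2 * lam ^ n := by positivity
    constructor
    · calc ((nawFourS d (n + 1)).card : ℝ) ≤ (nawFourWords d (n + 2)).card := by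
            exact_mod_cast card_nawFourS_succ_le d n
        _ = (nawFourS d n).card + (nawFourT d n).card := by
            rw [card_nawFourWords_eq]; push_cast; rfl
        _ ≤ 4 * d ^ 2 * lam ^ n + 4 * d ^ 2 * lam ^ n * (lam - 1) := add_le_add ihS ihT
        _ = 4 * d ^ 2 * lam ^ (n + 1) := by ring
    · have hT0 : (0 : ℝ) ≤ (nawFourT d n).card := Nat.cast_nonneg _
      have hS0 : (0 : ℝ) ≤ (nawFourS d n).card := Nat.cast_nonneg _
      have hd3 : (0 : ℝ) ≤ 2 * d - 3 := by
        have : (2 : ℝ) ≤ d := by exact_mod_cast hd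
        linarith
      have hd2 : (0 : ℝ) ≤ 2 * d - 2 := by linarith
      calc ((nawFourT d (n + 1)).card : ℝ)
          ≤ ((2 * d - 2 : ℕ) : ℝ) * (nawFourS d n).card + ((2 * d - 3 : ℕ) : ℝ) * (nawFourT d n).card := by
            exact_mod_cast card_nawFourT_succ_le d n
        _ = (2 * d - 2) * (nawFourS d n).card + (2 * d - 3) * (nawFourT d n).card := by rw [e2, e3]
        _ ≤ (2 * d - 2) * (4 * d ^ 2 * lam ^ n) + (2 * d - 3) * (4 * d ^ 2 * lam ^ n * (lam - 1)) :=
            add_le_add (mul_le_mul_of_nonneg_left ihS hd2) (mul_le_mul_of_nonneg_left ihT hd3)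
        _ ≤ 4 * d ^ 2 * lam ^ (n + 1) * (lam - 1) := by
            have key : (2 * d - 2) + (2 * d - 3) * (lam - 1) ≤ lam * (lam - 1) := by nlinarith
            calc (2 * d - 2) * (4 * d ^ 2 * lam ^ n) + (2 * d - 3) * (4 * d ^ 2 * lam ^ n * (lam - 1))
                = 4 * d ^ 2 * lam ^ n * ((2 * d - 2) + (2 * d - 3) * (lam - 1)) := by ring
              _ ≤ 4 * d ^ 2 * lam ^ n * (lam * (lam - 1)) := mul_le_mul_of_nonneg_left key hC
              _ = 4 * d ^ 2 * lam ^ (n + 1) * (lam - 1) := by ring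

/-- **`#nawFourWords d (n+2) ≤ 4d² λⁿ⁺¹`** under the same hypothesis on `λ`. [folklore] -/
theorem card_nawFourWords_le_geometric (hd : 2 ≤ d) {lam : ℝ} (hlam : 2 ≤ lam)
    (hroot : (2 * d - 2 : ℝ) * lam + 1 ≤ lam ^ 2) (n : ℕ) :
    ((nawFourWords d (n + 2)).card : ℝ) ≤ 4 * d ^ 2 * lam ^ (n + 1) := by
  obtain ⟨hS, hT⟩ := card_nawFourST_le hd hlam hroot n
  calc ((nawFourWords d (n + 2)).card : ℝ) = (nawFourS d n).card + (nawFourT d n).card := by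
        rw [card_nawFourWords_eq]; push_cast; rfl
    _ ≤ 4 * d ^ 2 * lam ^ n + 4 * d ^ 2 * lam ^ n * (lam - 1) := add_le_add hS hT
    _ = 4 * d ^ 2 * lam ^ (n + 1) := by ring

/-! ### Consequences for site percolation on `ℤ^d` -/

/-- **No site percolation below `1/λ`**: if `λ ≥ 2`, `λ² ≥ (2d-2)λ + 1` and `λ p < 1` then `θ^site(p) = 0`
(`θ^site(p) ≤ N_{n+2} p^{n+3} ≤ 4d² λ (λp)ⁿ⁺... → 0`). [folklore] -/
theorem siteTheta_zd_eq_zero_of_lt_inv (hd : 2 ≤ d) {lam : ℝ} (hlam : 2 ≤ lam)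
    (hroot : (2 * d - 2 : ℝ) * lam + 1 ≤ lam ^ 2) (p : unitInterval) (hp : lam * (p : ℝ) < 1) :
    siteTheta (zdGraph d) 0 p = 0 := by
  have hp0 : (0 : ℝ) ≤ p := p.2.1
  have hlp0 : 0 ≤ lam * (p : ℝ) := mul_nonneg (by linarith) hp0
  have hle : ∀ n : ℕ, siteTheta (zdGraph d) 0 p ≤ 4 * d ^ 2 * lam * (lam * (p : ℝ)) ^ n := by
    intro n
    calc siteTheta (zdGraph d) 0 p
        ≤ ((sawWords d (n + 2)).filter fun w => chordEdges w = ∅).card * (p : ℝ) ^ (n + 2 + 1) :=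
          siteTheta_le_card_nawWords_mul_pow d (n + 2) p
      _ ≤ (nawFourWords d (n + 2)).card * (p : ℝ) ^ (n + 2 + 1) :=
          mul_le_mul_of_nonneg_right (by exact_mod_cast card_nawWords_le_card_nawFourWords d (n + 2))
            (pow_nonneg hp0 _)
      _ ≤ 4 * d ^ 2 * lam ^ (n + 1) * (p : ℝ) ^ (n + 2 + 1) :=
          mul_le_mul_of_nonneg_right (card_nawFourWords_le_geometric hd hlam hroot n) (pow_nonneg hp0 _)
      _ = 4 * d ^ 2 * lam * (lam * (p : ℝ)) ^ n * (p : ℝ) ^ 3 := by rw [mul_pow]; ring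
      _ ≤ 4 * d ^ 2 * lam * (lam * (p : ℝ)) ^ n * 1 := by
          refine mul_le_mul_of_nonneg_left (pow_le_one₀ hp0 p.2.2) (by positivity)
      _ = 4 * d ^ 2 * lam * (lam * (p : ℝ)) ^ n := mul_one _
  have ht : Tendsto (fun n : ℕ => 4 * d ^ 2 * lam * (lam * (p : ℝ)) ^ n) atTop (𝓝 0) := by
    simpa using (tendsto_pow_atTop_nhds_zero_of_lt_one hlp0 hp).const_mul (4 * d ^ 2 * lam)
  exact le_antisymm (ge_of_tendsto' ht hle) measureReal_nonneg

/-- **`p_c^site(ℤ^d) ≥ 1/λ`** for every `λ ≥ 2` with `λ² ≥ (2d-2)λ + 1`. [folklore] -/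
theorem inv_le_siteCriticalProb_zd_of_sq (hd : 2 ≤ d) {lam : ℝ} (hlam : 2 ≤ lam)
    (hroot : (2 * d - 2 : ℝ) * lam + 1 ≤ lam ^ 2) : 1 / lam ≤ siteCriticalProb (zdGraph d) 0 := by
  have hl0 : 0 < lam := by linarith
  refine le_csInf ⟨1, Or.inr rfl⟩ ?_
  rintro q (⟨hq, hpos⟩ | hq)
  · by_contra hlt
    push Not at hlt
    have : lam * q < 1 := by
      have := (lt_div_iff₀ hl0).1 hlt
      linarith [this]
    exact hpos.ne' (siteTheta_zd_eq_zero_of_lt_inv hd hlam hroot ⟨q, hq⟩ this)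
  · rw [Set.mem_singleton_iff] at hq
    rw [hq, div_le_one hl0]
    linarith

/-- **The closed form: `p_c^site(ℤ^d) ≥ 1/((d-1) + √((d-1)²+1))`** for `d ≥ 2` (memory-4 neighbour-avoiding
walks; `d = 3`: `1/(2+√5) = 0.2360…`). [folklore] -/
theorem siteCriticalProb_zd_ge_inv_nawFourConst (hd : 2 ≤ d) :
    1 / ((d - 1 : ℝ) + Real.sqrt ((d - 1) ^ 2 + 1)) ≤ siteCriticalProb (zdGraph d) 0 := by
  have hd' : (2 : ℝ) ≤ d := by exact_mod_cast hd
  set r := Real.sqrt (((d : ℝ) - 1) ^ 2 + 1) with hr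
  have hr0 : 0 ≤ r := Real.sqrt_nonneg _
  have hr2 : r ^ 2 = ((d : ℝ) - 1) ^ 2 + 1 := Real.sq_sqrt (by positivity)
  have hr1 : 1 ≤ r := by nlinarith [sq_nonneg (r + 1)]
  refine inv_le_siteCriticalProb_zd_of_sq hd (lam := (d - 1 : ℝ) + r) (by linarith) ?_
  nlinarith [hr2]

/-- **`p_c^site(ℤ³) ≥ 0.236`** (printed best before this lane: `1/μ(3) = 0.2110`; `1/(2+√5) = 0.23606…`).
[folklore] -/
theorem siteCriticalProb_Z3_ge : (0.236 : ℝ) ≤ siteCriticalProb (zdGraph 3) 0 := by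
  have h5 : Real.sqrt 5 < 2.2361 := by
    rw [Real.sqrt_lt' (by norm_num)]; norm_num
  have h50 : 0 ≤ Real.sqrt 5 := Real.sqrt_nonneg 5
  have h55 : Real.sqrt 5 ^ 2 = 5 := Real.sq_sqrt (by norm_num)
  have key := inv_le_siteCriticalProb_zd_of_sq (d := 3) (by norm_num) (lam := 2 + Real.sqrt 5)
    (by linarith) (by push_cast; nlinarith [h55])
  have hpos : (0 : ℝ) < 2 + Real.sqrt 5 := by positivity
  calc (0.236 : ℝ) ≤ 1 / (2 + Real.sqrt 5) := by rw [le_div_iff₀ hpos]; nlinarith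
    _ ≤ siteCriticalProb (zdGraph 3) 0 := key

end Summit.CriticalPhenomena.PercolationContinuityZ3.Theorems.Pcint
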